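import Literature.AlgebraicGeometry.GroupSchemes.GroupSchemeActionOrbitSaturation
import Literature.RingTheory.Norm.NormFibrewiseUnits
import Mathlib.AlgebraicGeometry.Morphisms.QuasiFinite
import HarnessLib

/-!
# Stable affine neighbourhoods for a finite group-scheme action (Mumford AV §12, proof of Thm. 1)

Layer `Literature/AlgebraicGeometry/GroupSchemes`, namespace `Literature.AlgebraicGeometry.GroupSchemes.ActionOrbit`
(continuing ★ `GroupSchemeActionOrbitSaturation`).  Mathlib currency `[GrpObj G] [ModObj G X]` in `Over S`,
`S` any scheme.

* `exists_isAffineOpen_stable_of_orbit_subset` — **THE HEAD.**  If `pr₂ : G ×_S X → X` is finite (e.g.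
  `G → S` finite, ★ `isFinite_snd_left`) and the CHART property holds (over every affine open `V ⊆ X`,
  `Γ(pr₂⁻¹ V)` is a finite free `Γ(V)`-module through `pr₂^*` — true for `S`, `G` affine with `Γ(G)`
  finite free over `Γ(S)`, where `Γ(pr₂⁻¹ V) ≅ Γ(V) ⊗ Γ(G)`), then a point `x` whose orbit (the points
  `σ p` with `pr₂ p = x`) lies in an affine open `U` has a `G`-STABLE AFFINE open neighbourhood `W ⊆ U`
  (stable in the set-theoretic currency `pr₂ p ∈ W → σ p ∈ W` of ★ `ActionRestrict.liftOpen`).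

Road (Mumford p. 112, verbatim): `U′ = (σ(pr₂⁻¹ Uᶜ))ᶜ` is open (σ finite, ★ `isFinite_smul_left`) and
stable (★ `smul_mem_compl_of_snd_mem_compl`) and contains `x`; prime avoidance in `Γ(U)` (Mathlib
`Ideal.subset_union_prime`, the orbit of `x` being finite by `Scheme.Hom.finite_preimage_singleton`) gives
`f ∈ Γ(U)` vanishing on `U ∖ U′` and at no point of the orbit of `x`; `V = D(f) ⊆ U′` is affine; on the
affine `pr₂⁻¹ V` the section `s = σ^* f` has a norm `N = Nm_{Γ(pr₂⁻¹ V)∕Γ(V)}(s) ∈ Γ(V)`; by ★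
`Literature.RingTheory.Norm.norm_notMem_iff_forall_liesOver` («the norm detects fibrewise units») and
Mathlib `IsAffineOpen.comap_primeIdealOf_appLE`, `y ∈ D(N) ↔ orbit(y) ⊆ V`; hence `W = D(N)` is affine
(`IsAffineOpen.basicOpen`), contains `x`, and is stable (orbit transitivity ★ `exists_point_smul_trans`).
This is the finite-flat analogue of ★ `RelativeSpec.ActionOver.exists_stableAffineOpen_le_of_orbit`
(constant finite groups, `⋂ g⁻¹U`); it is organ Q3 ∕ risk (r1) of the §Q road (quotient of an abelian
scheme by a finite flat subgroup scheme, SGA 3 V Thm. 4.1) modulo the chart hypothesis (organ Q4).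
THEOREMS ONLY; no definition, no instance, no sorry.

## References
* [MumfordAV1970] D. Mumford, *Abelian Varieties* (1970), §12 Thm. 1 (p. 111) and its proof (p. 112).
-/

noncomputable section

universe u

open CategoryTheory Limits MonoidalCategory CartesianMonoidalCategory AlgebraicGeometry
open scoped MonObj

namespace Literature.AlgebraicGeometry.GroupSchemes.ActionOrbit

open Literature.RingTheory.Norm

section StableAffine

variable {S : Scheme.{u}} {G X : Over S} [GrpObj G] [ModObj G X]

/-- On an affine open `U`, `x ∈ D(r) ↔ r ∉ 𝔭_x`. [folklore] -/
private theorem mem_basicOpen_iff_notMem_primeIdealOf {Y : Scheme.{u}} {U : Y.Opens} (hU : IsAffineOpen U)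
    (r : Γ(Y, U)) {y : Y} (hy : y ∈ U) :
    y ∈ Y.basicOpen r ↔ r ∉ (hU.primeIdealOf ⟨y, hy⟩).asIdeal := by
  have hp : hU.fromSpec (hU.primeIdealOf ⟨y, hy⟩) = y := hU.fromSpec_primeIdealOf ⟨y, hy⟩
  rw [← PrimeSpectrum.mem_basicOpen (R := Γ(Y, U)), ← hU.fromSpec_preimage_basicOpen r]
  conv_lhs => rw [← hp]
  rfl

/-- `fromSpec z ∈ U`. [folklore] -/
private theorem fromSpec_mem {Y : Scheme.{u}} {U : Y.Opens} (hU : IsAffineOpen U) (z : Spec Γ(Y, U)) :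
    hU.fromSpec z ∈ U := by
  rw [← SetLike.mem_coe, ← hU.range_fromSpec]
  exact ⟨z, rfl⟩

/-- `𝔭_{fromSpec z} = z`: `primeIdealOf` is inverse to `fromSpec`. [folklore] -/
private theorem primeIdealOf_fromSpec {Y : Scheme.{u}} {U : Y.Opens} (hU : IsAffineOpen U) (z : Spec Γ(Y, U)) :
    hU.primeIdealOf ⟨hU.fromSpec z, fromSpec_mem hU z⟩ = z := by
  haveI : IsAffine U := hU
  have h1 : hU.isoSpec.hom (hU.isoSpec.inv z) = z := by
    rw [← Scheme.Hom.comp_apply, Iso.inv_hom_id]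
    rfl
  have h2 : (⟨hU.fromSpec z, fromSpec_mem hU z⟩ : U) = hU.isoSpec.inv z := Subtype.ext rfl
  rw [IsAffineOpen.primeIdealOf, h2, h1]

/-- **Stable affine neighbourhoods (Mumford, AV §12, proof of Thm. 1; SGA 3 V §5).**  Let the group
scheme `G → S` act on `X → S` with `pr₂ : G ×_S X → X` finite (e.g. `G → S` finite), and assume the
CHART property: over every affine open `V ⊆ X`, `Γ(pr₂⁻¹ V)` is a finite free `Γ(V)`-module (true when
`S`, `G` are affine with `Γ(G)` finite free over `Γ(S)`: `Γ(pr₂⁻¹ V) ≅ Γ(V) ⊗ Γ(G)`).  If the orbit of a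
point `x` (the points `σ p`, `pr₂ p = x`) lies in an affine open `U`, then `x` has a `G`-STABLE AFFINE open
neighbourhood `W ⊆ U`.  Construction: `U′ = {y | orbit(y) ⊆ U}` (open, stable); `f ∈ Γ(U)` vanishing on
`U ∖ U′` and on no point of the orbit of `x` (prime avoidance); `N = Nm_{Γ(pr₂⁻¹ D(f)) ∕ Γ(D(f))}(σ^* f)`;
`W = D(N) ⊆ D(f)`, whose points are exactly those `y ∈ D(f)` with `orbit(y) ⊆ D(f)` (the norm detects
fibrewise units). [cite: MumfordAV1970, §12 proof of Thm. 1 (p. 112)] -/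
theorem exists_isAffineOpen_stable_of_orbit_subset [IsFinite (snd G X).left]
    (hchart : ∀ V : X.left.Opens, IsAffineOpen V →
      letI := ((snd G X).left.app V).hom.toAlgebra
      Module.Free Γ(X.left, V) Γ((G ⊗ X).left, (snd G X).left ⁻¹ᵁ V) ∧
        Module.Finite Γ(X.left, V) Γ((G ⊗ X).left, (snd G X).left ⁻¹ᵁ V))
    (x : X.left) (U : X.left.Opens) (hU : IsAffineOpen U)
    (horb : ∀ p : ↑(G ⊗ X).left, (snd G X).left p = x → (γ[G, X]).left p ∈ U) :
    ∃ W : X.left.Opens, IsAffineOpen W ∧ x ∈ W ∧ W ≤ U ∧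
      ∀ p : ↑(G ⊗ X).left, (snd G X).left p ∈ W → (γ[G, X]).left p ∈ W := by
  classical
  haveI : IsFinite (γ[G, X]).left := isFinite_smul_left
  -- notation
  set σ : (G ⊗ X).left ⟶ X.left := (γ[G, X]).left with hσ
  set π : (G ⊗ X).left ⟶ X.left := (snd G X).left with hπ
  -- Step 1: the open stable set `U′ = {y | orbit(y) ⊆ U}`
  set F : Set X.left := (U : Set X.left)ᶜ with hF
  set U' : Set X.left := (σ '' (π ⁻¹' F))ᶜ with hU'
  have hU'open : IsOpen U' := isOpen_compl_smul_image_snd_preimage (G := G) (X := X) U.isOpen.isClosed_compl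
  have hU'sub : U' ⊆ (U : Set X.left) := by
    have := compl_smul_image_snd_preimage_subset (G := G) (X := X) F
    rwa [hF, compl_compl] at this
  have hU'mem : ∀ y, y ∈ U' ↔ ∀ p : ↑(G ⊗ X).left, π p = y → σ p ∈ U := by
    intro y
    rw [hU', Set.mem_compl_iff, notMem_smul_image_snd_preimage_iff]
    simp only [hF, Set.mem_compl_iff, not_not, SetLike.mem_coe]
    exact Iff.rfl
  have hxU' : x ∈ U' := (hU'mem x).mpr horb
  have hU'stab : ∀ p : ↑(G ⊗ X).left, π p ∈ U' → σ p ∈ U' :=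
    fun p hp => smul_mem_compl_of_snd_mem_compl (G := G) (X := X) F hp
  -- Step 2: prime avoidance in `C = Γ(X, U)`
  set Z : Set (PrimeSpectrum Γ(X.left, U)) := hU.fromSpec ⁻¹' U'ᶜ with hZ
  have hZcl : IsClosed Z := (hU'open.isClosed_compl).preimage hU.fromSpec.continuous
  set I : Ideal Γ(X.left, U) := PrimeSpectrum.vanishingIdeal Z with hI
  -- the primes of the orbit of `x`
  have hfib : (π ⁻¹' {x}).Finite := π.finite_preimage_singleton x
  set T : Set (PrimeSpectrum Γ(X.left, U)) := hU.fromSpec ⁻¹' (σ '' (π ⁻¹' {x})) with hT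
  have hTfin : T.Finite :=
    (hfib.image σ).preimage hU.fromSpec.isOpenEmbedding.injective.injOn
  have hTnot : ∀ q ∈ T, ¬ I ≤ q.asIdeal := by
    intro q hq hle
    have hq1 : q ∈ closure Z := by
      rw [← PrimeSpectrum.zeroLocus_vanishingIdeal_eq_closure]
      exact (PrimeSpectrum.mem_zeroLocus _ _).mpr hle
    have hq2 : q ∈ Z := hZcl.closure_subset hq1
    obtain ⟨p, hp, hpq⟩ := hq
    apply hq2
    rw [← hpq]
    exact hU'stab p (by rw [hp]; exact hxU')
  have hxU : x ∈ U := hU'sub hxU'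
  obtain ⟨f, hfI, hfT⟩ : ∃ f ∈ I, ∀ q ∈ T, f ∉ q.asIdeal := by
    have key : ¬ ((I : Set Γ(X.left, U)) ⊆
        ⋃ q ∈ (↑hTfin.toFinset : Set (PrimeSpectrum Γ(X.left, U))), ((q.asIdeal : Ideal Γ(X.left, U)) : Set Γ(X.left, U))) := by
      rw [Ideal.subset_union_prime (hU.primeIdealOf ⟨x, hxU⟩) (hU.primeIdealOf ⟨x, hxU⟩) (fun q _ _ _ => q.2)]
      rintro ⟨q, hq, hle⟩
      exact hTnot q (hTfin.mem_toFinset.mp hq) hle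
    obtain ⟨f, hfI, hf⟩ := Set.not_subset.mp key
    refine ⟨f, hfI, fun q hq hfq => hf ?_⟩
    exact Set.mem_biUnion (hTfin.mem_toFinset.mpr hq) hfq
  -- Step 3: `V = D(f)`: affine, `V ⊆ U′ ⊆ U`, contains the orbit of `x`
  set V : X.left.Opens := X.left.basicOpen f with hV
  have hVaff : IsAffineOpen V := hU.basicOpen f
  have hVU : V ≤ U := X.left.basicOpen_le f
  have hVU' : (V : Set X.left) ⊆ U' := by
    intro y hy
    by_contra hyU'
    have hyU : y ∈ U := hVU hy
    have hq : hU.primeIdealOf ⟨y, hyU⟩ ∈ Z := by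
      change hU.fromSpec (hU.primeIdealOf ⟨y, hyU⟩) ∈ U'ᶜ
      rw [hU.fromSpec_primeIdealOf]
      exact hyU'
    have hfq : f ∈ (hU.primeIdealOf ⟨y, hyU⟩).asIdeal := (PrimeSpectrum.mem_vanishingIdeal _ _).mp hfI _ hq
    exact ((mem_basicOpen_iff_notMem_primeIdealOf hU f hyU).mp hy) hfq
  have horbV : ∀ p : ↑(G ⊗ X).left, π p = x → σ p ∈ V := by
    intro p hp
    have hσpU : σ p ∈ U := horb p hp
    rw [hV, mem_basicOpen_iff_notMem_primeIdealOf hU f hσpU]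
    refine hfT _ ?_
    change hU.fromSpec (hU.primeIdealOf ⟨σ p, hσpU⟩) ∈ σ '' (π ⁻¹' {x})
    rw [hU.fromSpec_primeIdealOf]
    exact ⟨p, hp, rfl⟩
  have hVstabU' : ∀ p : ↑(G ⊗ X).left, π p ∈ V → σ p ∈ U := fun p hp => hU'sub (hU'stab p (hVU' hp))
  -- Step 4: the norm of `σ^* f` on `pr₂⁻¹ V`
  set P : (G ⊗ X).left.Opens := π ⁻¹ᵁ V with hP
  have hPaff : IsAffineOpen P := hVaff.preimage π
  have hPle : P ≤ σ ⁻¹ᵁ U := fun p hp => hVstabU' p hp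
  set s : Γ((G ⊗ X).left, P) := ((G ⊗ X).left.presheaf.map (homOfLE hPle).op) (σ.app U f) with hs
  have hsbasic : ∀ p : ↑(G ⊗ X).left, p ∈ (G ⊗ X).left.basicOpen s ↔ π p ∈ V ∧ σ p ∈ V := by
    intro p
    rw [hs, Scheme.basicOpen_res, ← Scheme.preimage_basicOpen]
    rfl
  obtain ⟨hfree, hfin⟩ := hchart V hVaff
  letI alg : Algebra Γ(X.left, V) Γ((G ⊗ X).left, P) := (π.app V).hom.toAlgebra
  set N : Γ(X.left, V) := Algebra.norm Γ(X.left, V) s with hN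
  -- Step 5: `D(N)` consists of the points of `V` whose orbit stays in `V`
  have hprime_over : ∀ (p : ↑(G ⊗ X).left) (hp : p ∈ P),
      ((hPaff.primeIdealOf ⟨p, hp⟩).asIdeal).comap (algebraMap Γ(X.left, V) Γ((G ⊗ X).left, P)) =
        (hVaff.primeIdealOf ⟨π p, hp⟩).asIdeal := by
    intro p hp
    have h := IsAffineOpen.comap_primeIdealOf_appLE (f := π) V hVaff P hPaff le_rfl hp
    have h' := congrArg PrimeSpectrum.asIdeal h
    rw [PrimeSpectrum.comap_asIdeal] at h'
    rw [← h']
    congr 1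
    change (π.app V).hom = (π.appLE V P le_rfl).hom
    rw [Scheme.Hom.appLE_eq_app]
  have hmemW : ∀ (y : X.left) (hy : y ∈ V),
      y ∈ X.left.basicOpen N ↔ ∀ q : ↑(G ⊗ X).left, π q = y → σ q ∈ V := by
    intro y hy
    rw [mem_basicOpen_iff_notMem_primeIdealOf hVaff N hy, hN,
      norm_notMem_iff_forall_liesOver ((hVaff.primeIdealOf ⟨y, hy⟩).asIdeal) s]
    constructor
    · intro h q hq
      have hqP : q ∈ P := by change π q ∈ V; rw [hq]; exact hy
      have := h _ (hPaff.primeIdealOf ⟨q, hqP⟩).2 (by rw [hprime_over q hqP]; simp_rw [hq])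
      rw [← mem_basicOpen_iff_notMem_primeIdealOf hPaff s hqP, hsbasic] at this
      exact this.2
    · intro h 𝔮 h𝔮 hover
      let z : Spec Γ((G ⊗ X).left, P) := ⟨𝔮, h𝔮⟩
      set q : ↑(G ⊗ X).left := hPaff.fromSpec z with hqdef
      have hqP : q ∈ P := fromSpec_mem hPaff z
      have hzq : hPaff.primeIdealOf ⟨q, hqP⟩ = z := primeIdealOf_fromSpec hPaff z
      have hπq : π q = y := by
        have h1 := hprime_over q hqP
        rw [hzq] at h1
        change 𝔮.comap _ = _ at h1
        rw [hover] at h1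
        have h2 : hVaff.primeIdealOf ⟨y, hy⟩ = hVaff.primeIdealOf ⟨π q, hqP⟩ := PrimeSpectrum.ext h1
        haveI : IsAffine V := hVaff
        have h3 := congrArg (fun w => (hVaff.fromSpec w : X.left)) h2
        simp only [IsAffineOpen.fromSpec_primeIdealOf] at h3
        exact h3.symm
      have hmem : q ∈ (G ⊗ X).left.basicOpen s := (hsbasic q).mpr ⟨hπq ▸ hy, h q hπq⟩
      rw [mem_basicOpen_iff_notMem_primeIdealOf hPaff s hqP, hzq] at hmem
      exact hmem
  -- Step 6: `W = D(N)`
  refine ⟨X.left.basicOpen N, hVaff.basicOpen N, ?_, (X.left.basicOpen_le N).trans hVU, ?_⟩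
  · have hxV : x ∈ V := by
      obtain ⟨p, hp1, hp2⟩ := exists_point_smul_self (G := G) (X := X) x
      have h := horbV p hp1
      rwa [show σ p = x from hp2] at h
    exact (hmemW x hxV).mpr horbV
  · intro p hp
    have hyV : π p ∈ V := X.left.basicOpen_le N hp
    have horb_y : ∀ q : ↑(G ⊗ X).left, π q = π p → σ q ∈ V := (hmemW (π p) hyV).mp hp
    have hzV : σ p ∈ V := horb_y p rfl
    refine (hmemW (σ p) hzV).mpr fun q hq => ?_
    obtain ⟨r, hr1, hr2⟩ := exists_point_smul_trans (G := G) (X := X) (p := p) (q := q) rfl hq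
    rw [← hr2]
    exact horb_y r hr1

end StableAffine

end Literature.AlgebraicGeometry.GroupSchemes.ActionOrbit

end
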